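import Mathlib
import HarnessLib
import Summits.HubbardSuperconductivity.HubbardSuperconductivity.Theorems.KLProgrammeKLRegimeEnginePairTransferCrossScaleMassBound
import Summits.HubbardSuperconductivity.HubbardSuperconductivity.Theorems.KLProgrammeKLRegimeTwoPointLimitCooperResummationSingleSlice

/-!
# Route `KLProgramme` — ENGINE item stmt-HubbardSuperconductivity-20437 `KLRegimeEngineV17F2`, stub (c) value lane, «(c)-OUT-UNSMEAR» typed as «UNSMEAR-RESUMMED»
# (plan g23 (R240) DESIGN WORD 2): member-vs-plain at scale `n` through a RELATIVE-CLAUSE datum — Neumann, the defect bar, and the «XS-PP-MASS» profile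
# (cell gate-hubbard-kl, seat hubbard-kl-k3c2-p2 g19; memo HOME/hubbard-kl-k3c2-p2/OUT-OF-CLASS-E2.md §8–§9a)

The un-smearing step (iii) of the out-of-class (E2″-F)ₙ₊₁ increment compares, at the frame `Kₙ`, the member array `A°ₙ[s_{n,n+1}]` (`klMemberArrayF … n (softSymbolCompl … n (n+1))`)
with the plain array `A°ₙ[0] = klPairArrayF … n` (`klMemberArrayF_zero`).  Class #5's relative clause (`PairTransferRelAt`, …RelDefs) supplies, per `Qm`, a two-sided
inverse `N` of `1 − diag(tₙ[ψ₁] − tₙ[ψ₂])·A°ₙ[ψ₂]` and the defect `‖A°ₙ[ψ₁] − A°ₙ[ψ₂]·N‖ ≤ Tb` on the bare ball.  Hence (NO second-step calculus):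
* §1 `unsmear_entry_le` (generic): `(1 − diag z·A)·N = 1`, `|A| ≤ m`, `m·Σ|z| ≤ 1/3` ⇒ `‖(A·N)(x,y) − A(x,y)‖ ≤ (3/2)·m·(m·Σ|z|)` (k3c1-p1's `klcrs_single_slice`, read at `−z`);
* §2 **`member_sub_le_of_relData`** (model, class-AGNOSTIC: the clause's ∃-data are the hypotheses, so the in-class clause and an all-`Qm` twin both plug in):
  `‖A°ₙ[ψ₁](k,k′) − A°ₙ[ψ₂](k,k′)‖ ≤ Tb Qm k k′ + (3/2)·m·(m·Σ_p |tₙ[ψ₁](Qm,p) − tₙ[ψ₂](Qm,p)|)` on the bare ball;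
  `member_sub_plain_le_of_relData` (`ψ₂ = 0`: `tₙ[0] = 0`, `A°ₙ[0] =` plain); `member_sub_plain_le_of_pairTransferRelAt` (the landed IN-CLASS clause, `IsPairClassAt Qm n`);
* §3 **`member_sub_plain_le_shellLog`** — with the a priori `m² ≤ 2⁸(Klam U)²` and «XS-PP-MASS» (`sum_abs_klTransferWeight_le_shellLog` at `K := Kₙ`, frozen total momentum
  `Λₙ ≤ ρ = |p_Qm|_𝕋`): `‖A°ₙ[s_{n,n+1}](k,k′) − plain(k,k′)‖ ≤ Tb Qm k k′ + (Klam U)²·(2¹⁷·klTS + 2²⁷)·(klRelGain n ρ + 2⁻ⁿ)` (`384·(90κ_G klTS + 2¹⁸) ≤ 2¹⁷klTS + 2²⁷`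
  at `G ≤ 5`) — the Neumann term in the shape of `xsMass_le_gainBar_klEngGeo13` (…DefsG13), the defect `Tb` left BY NAME (class #5's bar, a second copy of the step's slots).
Composition only; nothing about the model's sizes is asserted; nothing asserts (E2″-F), (c), K3 or superconductivity.  0 kit · 0 lit.
-/

noncomputable section

namespace Summit.HubbardSuperconductivity.HubbardSuperconductivity.Theorems.KLRegimeSplit

set_option linter.dupNamespace false -- summit = problem name (single-conjunct summit), D-0017

open Real Finset Matrix Literature.MathematicalPhysics.QuantumLattice Literature.Probability.LatticeModels
open Summit.HubbardSuperconductivity.HubbardSuperconductivity.Theorems.KLProgrammeLegKernels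
open Summit.HubbardSuperconductivity.HubbardSuperconductivity.Theorems.KLProgrammeCooperResummation
open Summit.HubbardSuperconductivity.HubbardSuperconductivity.Theorems.TwoPointAssembly
open Summit.HubbardSuperconductivity.HubbardSuperconductivity.Theorems.DispersionFlow
open Summit.HubbardSuperconductivity.HubbardSuperconductivity.Theorems.EngineV8

/-! ## §1 Neumann: first-order accuracy of a resummation -/

section Generic

variable {ι : Type*} [Fintype ι] [DecidableEq ι] [Nonempty ι]

/-- **First-order accuracy**: `(1 − diag z·A)·N = 1`, `|A| ≤ m`, `m·Σ|z| ≤ 1/3` ⇒ `‖(A·N)(x,y) − A(x,y)‖ ≤ (3/2)·m·(m·Σ|z|)`. -/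
theorem unsmear_entry_le (A N : Matrix ι ι ℂ) (z : ι → ℂ) {m : ℝ} (hm : 0 ≤ m) (hA : ∀ x y, ‖A x y‖ ≤ m)
    (hz : m * ∑ a, ‖z a‖ ≤ 1 / 3) (hN : (1 - diagonal z * A) * N = 1) (x y : ι) :
    ‖(A * N) x y - A x y‖ ≤ 3 / 2 * m * (m * ∑ a, ‖z a‖) := by
  have hz' : m * ∑ a, ‖(-z) a‖ ≤ 1 / 3 := by simpa using hz
  obtain ⟨N₁, _, hN₁1, hN₁2, -, -, -, -, -, -, hfirst, -⟩ := klcrs_single_slice (-z) hm A hA hz'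
  have hdiag : (1 : Matrix ι ι ℂ) + diagonal (-z) * A = 1 - diagonal z * A := by
    have : diagonal (-z) = -diagonal z := by ext i j; simp [diagonal_apply]; split_ifs <;> simp
    rw [this, neg_mul, ← sub_eq_add_neg]
  rw [hdiag] at hN₁1 hN₁2
  have hNN : N = N₁ := by
    calc N = N₁ * (1 - diagonal z * A) * N := by rw [hN₁2, one_mul]
      _ = N₁ := by rw [mul_assoc, hN, mul_one]
  subst hNN
  have h := hfirst x y
  rw [Matrix.sub_apply] at h
  simpa using h

end Generic

/-! ## §2 Member versus member / plain from a relative-clause datum -/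

section Model

variable {L M : ℕ} [NeZero L] [NeZero M] (β U μ : ℝ)

/-- **MEMBER vs MEMBER from the relative clause's data** (class-agnostic): for a pair `(ψ₁ | ψ₂)` at scale `n` and a total momentum `Qm`, a right inverse `N` of
`1 − diag(tₙ[ψ₁] − tₙ[ψ₂])·A°ₙ[ψ₂]`, the defect `‖A°ₙ[ψ₁] − A°ₙ[ψ₂]·N‖ ≤ Tb` on the bare ball, the a priori `|A°ₙ[ψ₂]| ≤ m` and the smallness `m·Σ_p|tₙ[ψ₁] − tₙ[ψ₂]| ≤ 1/3` give
`‖A°ₙ[ψ₁](k,k′) − A°ₙ[ψ₂](k,k′)‖ ≤ Tb Qm k k′ + (3/2)·m·(m·Σ_p|tₙ[ψ₁](Qm,p) − tₙ[ψ₂](Qm,p)|)` on the bare ball. -/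
theorem member_sub_le_of_relData (n : ℕ) (ψ₁ ψ₂ : FreqMomentum L M → ℝ) (Qm : TorusSite 2 L)
    (Tb : TorusSite 2 L → TorusSite 2 L → TorusSite 2 L → ℝ) (N : Matrix (TorusSite 2 L) (TorusSite 2 L) ℂ)
    (hN : (1 - diagonal (fun p => ((klTransferWeight L M β μ (klFlowFrameU L M β U μ n) n ψ₁ Qm p -
          klTransferWeight L M β μ (klFlowFrameU L M β U μ n) n ψ₂ Qm p : ℝ) : ℂ)) * klMemberArrayF L M β U μ n ψ₂ Qm) * N = 1)
    (hdef : ∀ k ∈ klBall L μ 0, ∀ k' ∈ klBall L μ 0,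
      ‖klMemberArrayF L M β U μ n ψ₁ Qm k k' - (klMemberArrayF L M β U μ n ψ₂ Qm * N) k k'‖ ≤ Tb Qm k k')
    {m : ℝ} (hm : 0 ≤ m) (hA : ∀ s t, ‖klMemberArrayF L M β U μ n ψ₂ Qm s t‖ ≤ m)
    (hsm : m * ∑ p, |klTransferWeight L M β μ (klFlowFrameU L M β U μ n) n ψ₁ Qm p - klTransferWeight L M β μ (klFlowFrameU L M β U μ n) n ψ₂ Qm p| ≤ 1 / 3)
    {k k' : TorusSite 2 L} (hk : k ∈ klBall L μ 0) (hk' : k' ∈ klBall L μ 0) :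
    ‖klMemberArrayF L M β U μ n ψ₁ Qm k k' - klMemberArrayF L M β U μ n ψ₂ Qm k k'‖ ≤
      Tb Qm k k' + 3 / 2 * m * (m * ∑ p, |klTransferWeight L M β μ (klFlowFrameU L M β U μ n) n ψ₁ Qm p -
        klTransferWeight L M β μ (klFlowFrameU L M β U μ n) n ψ₂ Qm p|) := by
  set z : TorusSite 2 L → ℂ := fun p => ((klTransferWeight L M β μ (klFlowFrameU L M β U μ n) n ψ₁ Qm p -
    klTransferWeight L M β μ (klFlowFrameU L M β U μ n) n ψ₂ Qm p : ℝ) : ℂ) with hz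
  have hnorm : ∑ p, ‖z p‖ = ∑ p, |klTransferWeight L M β μ (klFlowFrameU L M β U μ n) n ψ₁ Qm p -
      klTransferWeight L M β μ (klFlowFrameU L M β U μ n) n ψ₂ Qm p| := sum_congr rfl fun p _ => by
    rw [hz]; exact Complex.norm_real _
  have hz3 : m * ∑ p, ‖z p‖ ≤ 1 / 3 := by rw [hnorm]; exact hsm
  have h1 := unsmear_entry_le (klMemberArrayF L M β U μ n ψ₂ Qm) N z hm hA hz3 hN k k'
  rw [hnorm] at h1
  have h2 := hdef k hk k' hk'
  calc ‖klMemberArrayF L M β U μ n ψ₁ Qm k k' - klMemberArrayF L M β U μ n ψ₂ Qm k k'‖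
      = ‖(klMemberArrayF L M β U μ n ψ₁ Qm k k' - (klMemberArrayF L M β U μ n ψ₂ Qm * N) k k') +
          ((klMemberArrayF L M β U μ n ψ₂ Qm * N) k k' - klMemberArrayF L M β U μ n ψ₂ Qm k k')‖ := by ring_nf
    _ ≤ ‖klMemberArrayF L M β U μ n ψ₁ Qm k k' - (klMemberArrayF L M β U μ n ψ₂ Qm * N) k k'‖ +
          ‖(klMemberArrayF L M β U μ n ψ₂ Qm * N) k k' - klMemberArrayF L M β U μ n ψ₂ Qm k k'‖ := norm_add_le _ _
    _ ≤ _ := add_le_add h2 h1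

/-- **MEMBER vs PLAIN** (`ψ₂ = 0`: `tₙ[0] = 0`, `A°ₙ[0] = klPairArrayF`): from the relative datum of the pair `(ψ | 0)` at `Qm`,
`‖A°ₙ[ψ](k,k′) − klPairArrayF … n Qm k k′‖ ≤ Tb Qm k k′ + (3/2)·m·(m·Σ_p|tₙ[ψ](Qm,p)|)` on the bare ball. -/
theorem member_sub_plain_le_of_relData (n : ℕ) (ψ : FreqMomentum L M → ℝ) (Qm : TorusSite 2 L)
    (Tb : TorusSite 2 L → TorusSite 2 L → TorusSite 2 L → ℝ) (N : Matrix (TorusSite 2 L) (TorusSite 2 L) ℂ)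
    (hN : (1 - diagonal (fun p => ((klTransferWeight L M β μ (klFlowFrameU L M β U μ n) n ψ Qm p -
          klTransferWeight L M β μ (klFlowFrameU L M β U μ n) n (fun _ => 0) Qm p : ℝ) : ℂ)) * klMemberArrayF L M β U μ n (fun _ => 0) Qm) * N = 1)
    (hdef : ∀ k ∈ klBall L μ 0, ∀ k' ∈ klBall L μ 0,
      ‖klMemberArrayF L M β U μ n ψ Qm k k' - (klMemberArrayF L M β U μ n (fun _ => 0) Qm * N) k k'‖ ≤ Tb Qm k k')
    {m : ℝ} (hm : 0 ≤ m) (hA : ∀ s t, ‖klPairArrayF L M β U μ n Qm s t‖ ≤ m)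
    (hsm : m * ∑ p, |klTransferWeight L M β μ (klFlowFrameU L M β U μ n) n ψ Qm p| ≤ 1 / 3)
    {k k' : TorusSite 2 L} (hk : k ∈ klBall L μ 0) (hk' : k' ∈ klBall L μ 0) :
    ‖klMemberArrayF L M β U μ n ψ Qm k k' - klPairArrayF L M β U μ n Qm k k'‖ ≤
      Tb Qm k k' + 3 / 2 * m * (m * ∑ p, |klTransferWeight L M β μ (klFlowFrameU L M β U μ n) n ψ Qm p|) := by
  have h0 : ∀ p, klTransferWeight L M β μ (klFlowFrameU L M β U μ n) n ψ Qm p -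
      klTransferWeight L M β μ (klFlowFrameU L M β U μ n) n (fun _ => 0) Qm p =
        klTransferWeight L M β μ (klFlowFrameU L M β U μ n) n ψ Qm p := fun p => by
    rw [klTransferWeight_zero_symbol, sub_zero]
  have hA' : ∀ s t, ‖klMemberArrayF L M β U μ n (fun _ => 0) Qm s t‖ ≤ m := fun s t => by rw [klMemberArrayF_zero]; exact hA s t
  have hsm' : m * ∑ p, |klTransferWeight L M β μ (klFlowFrameU L M β U μ n) n ψ Qm p -
      klTransferWeight L M β μ (klFlowFrameU L M β U μ n) n (fun _ => 0) Qm p| ≤ 1 / 3 := by simp_rw [h0]; exact hsm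
  have h := member_sub_le_of_relData β U μ n ψ (fun _ => 0) Qm Tb N hN hdef hm hA' hsm' hk hk'
  simp_rw [h0, klMemberArrayF_zero] at h
  exact h

/-- **MEMBER vs PLAIN from the LANDED in-class clause**: `PairTransferRelAt … n Tb ψ 0` and `IsPairClassAt Qm n` (the all-`Qm` twin, when it lands, feeds
`member_sub_plain_le_of_relData` the same way for the out-of-class `Qm`). -/
theorem member_sub_plain_le_of_pairTransferRelAt {n : ℕ} {ψ : FreqMomentum L M → ℝ} {Tb : TorusSite 2 L → TorusSite 2 L → TorusSite 2 L → ℝ}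
    (h : PairTransferRelAt L M β U μ n Tb ψ (fun _ => 0)) {Qm : TorusSite 2 L} (hQ : IsPairClassAt L Qm n)
    {m : ℝ} (hm : 0 ≤ m) (hA : ∀ s t, ‖klPairArrayF L M β U μ n Qm s t‖ ≤ m)
    (hsm : m * ∑ p, |klTransferWeight L M β μ (klFlowFrameU L M β U μ n) n ψ Qm p| ≤ 1 / 3)
    {k k' : TorusSite 2 L} (hk : k ∈ klBall L μ 0) (hk' : k' ∈ klBall L μ 0) :
    ‖klMemberArrayF L M β U μ n ψ Qm k k' - klPairArrayF L M β U μ n Qm k k'‖ ≤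
      Tb Qm k k' + 3 / 2 * m * (m * ∑ p, |klTransferWeight L M β μ (klFlowFrameU L M β U μ n) n ψ Qm p|) := by
  obtain ⟨N, hN, -, hdef⟩ := h Qm hQ
  exact member_sub_plain_le_of_relData β U μ n ψ Qm Tb N hN hdef hm hA hsm hk hk'

/-! ## §3 The Neumann term in the pp shell-log slot («XS-PP-MASS») -/

/-- `384·(90κ_G·klTS + 2¹⁸) ≤ 2¹⁷·klTS + 2²⁷` for `G ≤ 5` (`κ_G = 7/(4π²) + 2G/π ≤ 3.37`). -/
theorem xs_numerals_le {G : ℝ} (hG0 : 0 ≤ G) (hG : G ≤ 5) :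
    384 * (90 * (7 / (4 * π ^ 2) + 2 * G / π) * klTS + 2 ^ 18) ≤ 2 ^ 17 * klTS + 2 ^ 27 := by
  have hπ : 3.14 < π := Real.pi_gt_d2
  have hT := klTS_nonneg
  have hκ : 7 / (4 * π ^ 2) + 2 * G / π ≤ 3.37 := by
    have h1 : 7 / (4 * π ^ 2) ≤ 0.18 := by
      rw [div_le_iff₀ (by positivity)]; nlinarith
    have h2 : 2 * G / π ≤ 3.19 := by
      rw [div_le_iff₀ (by positivity)]; nlinarith
    linarith
  have hκ0 : 0 ≤ 7 / (4 * π ^ 2) + 2 * G / π := by positivity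
  nlinarith [mul_le_mul_of_nonneg_right hκ hT]

/-- **THE NEUMANN TERM OF (iii) IN THE pp SHELL-LOG SLOT**: at the frame `Kₙ = klFlowFrameU … n` (`FrameOK R U N Kₙ`, `R.WF2`, `0 < U ≤ klTSU R`, `μ ∈ klWindowC`,
`klBetaMin ≤ β ≤ L`, `n ≤ nScales β`, `8Gβ ≤ L`, `(8/3)Gfr₁U² ≤ 1`), for a soft member `0 ≤ ψ ≤ 1 − w^{Kₙ}_{Λₙ}`, `m² ≤ 2⁸(Klam U)²` and a frozen total
momentum `Λₙ ≤ |p_Qm|_𝕋`: `(3/2)·m·(m·Σ_p|tₙ[ψ](Qm,p)|) ≤ (Klam U)²·(2¹⁷·klTS + 2²⁷)·(klRelGain n |p_Qm|_𝕋 + 2⁻ⁿ)`. -/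
theorem neumannTerm_le_shellLog {R : RenConsts} (hR : R.WF2) (hU : 0 < U) (hUu : U ≤ klTSU R) (hμ : μ ∈ klWindowC) {N₀ : ℕ} {n : ℕ}
    (hK : FrameOK R U N₀ μ (klFlowFrameU L M β U μ n)) (hβ : klBetaMin ≤ β) (hβL : β ≤ (L : ℝ)) (hn : n ≤ nScales β)
    (hGL : 8 * (4 + 8 / 3 * R.Gfr 1 * U ^ 2) * β ≤ L) (hGU : 8 / 3 * R.Gfr 1 * U ^ 2 ≤ 1)
    {ψ : FreqMomentum L M → ℝ} (hψ : ∀ k, 0 ≤ ψ k ∧ ψ k ≤ 1 - hubbardCutoffWeightCT L M β μ (klFlowFrameU L M β U μ n) (klScale klE0 n) k)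
    {P : SplitConsts} {m : ℝ} (hmK : m ^ 2 ≤ 2 ^ 8 * (P.Klam * U) ^ 2)
    (Qm : TorusSite 2 L) (hρ : klScale klE0 n ≤ klTorusNorm L Qm) :
    3 / 2 * m * (m * ∑ p, |klTransferWeight L M β μ (klFlowFrameU L M β U μ n) n ψ Qm p|) ≤
      (P.Klam * U) ^ 2 * ((2 ^ 17 * klTS + 2 ^ 27) * (klRelGain n (klTorusNorm L Qm) + ((2 : ℝ) ^ n)⁻¹)) := by
  have hX := sum_abs_klTransferWeight_le_shellLog (M := M) hR hU hUu hμ hK hβ hβL hn hGL hψ Qm hρ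
  have hGfr : ∀ j, 0 ≤ R.Gfr j := hR.wf.2.2
  have hG0 : 0 ≤ 4 + 8 / 3 * R.Gfr 1 * U ^ 2 := by nlinarith [hGfr 1, sq_nonneg U]
  have hG5 : 4 + 8 / 3 * R.Gfr 1 * U ^ 2 ≤ 5 := by linarith
  have hnum := xs_numerals_le hG0 hG5
  have hΛ : 0 < klScale klE0 n := klth_klScale_pos n
  have hρ0 : 0 ≤ klTorusNorm L Qm := hΛ.le.trans hρ
  have hg : 0 ≤ klRelGain n (klTorusNorm L Qm) + ((2 : ℝ) ^ n)⁻¹ := by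
    have := klRelGain_nonneg n hρ0; positivity
  have hS0 : 0 ≤ ∑ p, |klTransferWeight L M β μ (klFlowFrameU L M β U μ n) n ψ Qm p| := sum_nonneg fun p _ => abs_nonneg _
  have hT := klTS_nonneg
  have hπ := Real.pi_pos
  have hC0 : 0 ≤ 90 * (7 / (4 * π ^ 2) + 2 * (4 + 8 / 3 * R.Gfr 1 * U ^ 2) / π) * klTS + 2 ^ 18 := by positivity
  -- `(3/2)·m²·S ≤ (3/2)·m²·C·g ≤ (3/2)·2⁸K·C·g = K·384·C·g ≤ K·(2¹⁷klTS + 2²⁷)·g`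
  have h1 : 3 / 2 * m * (m * ∑ p, |klTransferWeight L M β μ (klFlowFrameU L M β U μ n) n ψ Qm p|) ≤
      3 / 2 * m ^ 2 * ((90 * (7 / (4 * π ^ 2) + 2 * (4 + 8 / 3 * R.Gfr 1 * U ^ 2) / π) * klTS + 2 ^ 18) *
        (klRelGain n (klTorusNorm L Qm) + ((2 : ℝ) ^ n)⁻¹)) := by
    have := mul_le_mul_of_nonneg_left hX (by positivity : 0 ≤ 3 / 2 * m ^ 2)
    nlinarith
  have hK : 0 ≤ (P.Klam * U) ^ 2 := sq_nonneg _
  have h2 : 3 / 2 * m ^ 2 * ((90 * (7 / (4 * π ^ 2) + 2 * (4 + 8 / 3 * R.Gfr 1 * U ^ 2) / π) * klTS + 2 ^ 18) *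
        (klRelGain n (klTorusNorm L Qm) + ((2 : ℝ) ^ n)⁻¹)) ≤
      (P.Klam * U) ^ 2 * ((2 ^ 17 * klTS + 2 ^ 27) * (klRelGain n (klTorusNorm L Qm) + ((2 : ℝ) ^ n)⁻¹)) := by
    have hCg := mul_nonneg hC0 hg
    have step1 : 3 / 2 * m ^ 2 * ((90 * (7 / (4 * π ^ 2) + 2 * (4 + 8 / 3 * R.Gfr 1 * U ^ 2) / π) * klTS + 2 ^ 18) *
        (klRelGain n (klTorusNorm L Qm) + ((2 : ℝ) ^ n)⁻¹)) ≤
        (P.Klam * U) ^ 2 * (384 * ((90 * (7 / (4 * π ^ 2) + 2 * (4 + 8 / 3 * R.Gfr 1 * U ^ 2) / π) * klTS + 2 ^ 18)) *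
          (klRelGain n (klTorusNorm L Qm) + ((2 : ℝ) ^ n)⁻¹)) := by nlinarith
    have step2 : (P.Klam * U) ^ 2 * (384 * ((90 * (7 / (4 * π ^ 2) + 2 * (4 + 8 / 3 * R.Gfr 1 * U ^ 2) / π) * klTS + 2 ^ 18)) *
          (klRelGain n (klTorusNorm L Qm) + ((2 : ℝ) ^ n)⁻¹)) ≤
        (P.Klam * U) ^ 2 * ((2 ^ 17 * klTS + 2 ^ 27) * (klRelGain n (klTorusNorm L Qm) + ((2 : ℝ) ^ n)⁻¹)) := by
      have h := mul_le_mul_of_nonneg_right hnum hg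
      have h' := mul_le_mul_of_nonneg_left h hK
      linarith [h']
    exact step1.trans step2
  exact h1.trans h2

/-- **«UNSMEAR-RESUMMED», ASSEMBLED (class-agnostic datum)**: with the relative datum of the pair `(s_{n,n+1} | 0)` at `Qm` (inverse `N`, defect `≤ Tb`), the a priori
`|plain| ≤ m`, `m² ≤ 2⁸(Klam U)²`, the smallness `m·Σ|t| ≤ 1/3`, the frame/regime data of `neumannTerm_le_shellLog` and `Λₙ ≤ |p_Qm|_𝕋`:
`‖A°ₙ[s_{n,n+1}](k,k′) − plain(k,k′)‖ ≤ Tb Qm k k′ + (Klam U)²·(2¹⁷·klTS + 2²⁷)·(klRelGain n |p_Qm|_𝕋 + 2⁻ⁿ)` on the bare ball. -/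
theorem member_sub_plain_le_shellLog {R : RenConsts} (hR : R.WF2) (hU : 0 < U) (hUu : U ≤ klTSU R) (hμ : μ ∈ klWindowC) {N₀ : ℕ} {n : ℕ}
    (hK : FrameOK R U N₀ μ (klFlowFrameU L M β U μ n)) (hβ : klBetaMin ≤ β) (hβL : β ≤ (L : ℝ)) (hn : n ≤ nScales β)
    (hGL : 8 * (4 + 8 / 3 * R.Gfr 1 * U ^ 2) * β ≤ L) (hGU : 8 / 3 * R.Gfr 1 * U ^ 2 ≤ 1)
    (hψ : ∀ k, 0 ≤ softSymbolCompl L M β μ (klFlowFrameU L M β U μ n) n (n + 1) k ∧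
      softSymbolCompl L M β μ (klFlowFrameU L M β U μ n) n (n + 1) k ≤ 1 - hubbardCutoffWeightCT L M β μ (klFlowFrameU L M β U μ n) (klScale klE0 n) k)
    (Qm : TorusSite 2 L) (Tb : TorusSite 2 L → TorusSite 2 L → TorusSite 2 L → ℝ) (N : Matrix (TorusSite 2 L) (TorusSite 2 L) ℂ)
    (hN : (1 - diagonal (fun p => ((klTransferWeight L M β μ (klFlowFrameU L M β U μ n) n (softSymbolCompl L M β μ (klFlowFrameU L M β U μ n) n (n + 1)) Qm p -
          klTransferWeight L M β μ (klFlowFrameU L M β U μ n) n (fun _ => 0) Qm p : ℝ) : ℂ)) * klMemberArrayF L M β U μ n (fun _ => 0) Qm) * N = 1)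
    (hdef : ∀ k ∈ klBall L μ 0, ∀ k' ∈ klBall L μ 0,
      ‖klMemberArrayF L M β U μ n (softSymbolCompl L M β μ (klFlowFrameU L M β U μ n) n (n + 1)) Qm k k' -
          (klMemberArrayF L M β U μ n (fun _ => 0) Qm * N) k k'‖ ≤ Tb Qm k k')
    {P : SplitConsts} {m : ℝ} (hm : 0 ≤ m) (hmK : m ^ 2 ≤ 2 ^ 8 * (P.Klam * U) ^ 2) (hA : ∀ s t, ‖klPairArrayF L M β U μ n Qm s t‖ ≤ m)
    (hsm : m * ∑ p, |klTransferWeight L M β μ (klFlowFrameU L M β U μ n) n (softSymbolCompl L M β μ (klFlowFrameU L M β U μ n) n (n + 1)) Qm p| ≤ 1 / 3)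
    (hρ : klScale klE0 n ≤ klTorusNorm L Qm) {k k' : TorusSite 2 L} (hk : k ∈ klBall L μ 0) (hk' : k' ∈ klBall L μ 0) :
    ‖klMemberArrayF L M β U μ n (softSymbolCompl L M β μ (klFlowFrameU L M β U μ n) n (n + 1)) Qm k k' - klPairArrayF L M β U μ n Qm k k'‖ ≤
      Tb Qm k k' + (P.Klam * U) ^ 2 * ((2 ^ 17 * klTS + 2 ^ 27) * (klRelGain n (klTorusNorm L Qm) + ((2 : ℝ) ^ n)⁻¹)) := by
  have h1 := member_sub_plain_le_of_relData β U μ n _ Qm Tb N hN hdef hm hA hsm hk hk'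
  have h2 := neumannTerm_le_shellLog β U μ hR hU hUu hμ hK hβ hβL hn hGL hGU hψ hmK Qm hρ
  linarith

end Model

end Summit.HubbardSuperconductivity.HubbardSuperconductivity.Theorems.KLRegimeSplit

end
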